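import Literature.MathematicalPhysics.QuantumLattice.DWaveSourceNNNHoppingEnergyDensityExists
import Literature.MathematicalPhysics.QuantumLattice.DWaveKomaTasakiThermal
import HarnessLib

/-!
# Complex (phase-rotated) pair sources: `E₀(H − μN − (z̄Δ_d + zΔ_d†)) = E_L(|z|)` by a gauge rotation,
# and `E₀(A_L(h₀) − (z̄Δ_d + zΔ_d†)) ≥ E_L(h₀ + |z|)`

Topic `Literature/MathematicalPhysics/QuantumLattice` (namespace = path). Seat `hubbard-cq-p4` (cell
`pub/hubbard-cq`): step (γ) of transplant-1's DICTIONARY v4 §12 chain for the infinite-volume LRO ceiling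
(`TIGroundStatePairLROCeiling`): «complex sources: `E₀(T − √g(c̄Δ + cΔ†)) = E_L(|h₀ + √g c|) ≥ E_L(h₀ + √g|c|)`
by `gaugeAut (arg/2)` (`γ_θ(Δ) = e^{−2iθ}Δ`; `T −` source gauge invariant) + `groundEnergy_dWaveSourceTorusTT'_anti`».
Everything is PROVED; no definition, no named fact. (`Δ_d = pairField dWaveFormFactor L`,
`A_L(h) = dWaveSourceTorusTT' L t' U μ h = H^{tt'} − μN − h(Δ_d + Δ_d†)`, `E_L(h) = E₀(A_L(h))`.)

* `gaugeAut_dWaveSourceTorusTT'_zero` — the source-free grand-canonical `t–t'` torus is gauge invariant.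
* `gaugeAut_phaseSource` — `γ_θ(z̄Δ_g + zΔ_g†) = conj(z e^{2iθ})·Δ_g + (z e^{2iθ})·Δ_g†`: the gauge action
  ROTATES THE PHASE of a complex pair source (`Δ_g` has charge `−2`, `hasGaugeCharge_pairField`).
* **`groundEnergy_dWaveSourceTorusTT'_sub_phaseSource`** — `E₀(A_L(0) − (z̄Δ_d + zΔ_d†)) = E_L(|z|)`: rotate by
  `θ = −arg z/2` (unitary conjugation by `e^{iθN̂}` preserves the ground energy); the sourced ground energy
  depends on the source only through its MODULUS — the Bogoliubov-Jr. approximating-Hamiltonian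
  minimisation over complex `c` reduces to real `c ≥ 0`.
* **`groundEnergy_dWaveSourceTorusTT'_add_le_groundEnergy_sub_phaseSource`** — for `h₀ ≥ 0`:
  `E_L(h₀ + |z|) ≤ E₀(A_L(h₀) − (z̄Δ_d + zΔ_d†))` (the total complex source is `h₀ + z`, `|h₀ + z| ≤ h₀ + |z|`,
  and `E_L` is antitone on `[0, ∞)`); `t' = 0` forms via `dWaveSourceTorusTT'_zero_tp`.

## References
* O. Bratteli, D. W. Robinson, *OAQSM 2* (1997), §5.2.2 (gauge automorphisms). [cite: BratteliRobinsonII1997, §5.2.2]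
* J.-B. Bru, W. de Siqueira Pedra, Mem. AMS 224 (2013) no. 1052, §2.1 and Thm. 10.7 (approximating
  Hamiltonians; the variational problem over the complex order parameter `c` is gauge invariant, depends on
  `|c|`). [cite: BruPedra2013, §2.1]
* T. Koma, H. Tasaki, J. Stat. Phys. 76 (1994) 745–803, §1 (sourced ground energies). [cite: KomaTasaki1994, §1]
-/

noncomputable section

open Matrix Complex Finset Filter Literature.Probability.LatticeModels
open scoped Matrix.Norms.L2Operator ComplexOrder

namespace Literature.MathematicalPhysics.QuantumLattice

section PhaseRotation

variable (L : ℕ) [NeZero L] (t' U μ : ℝ)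

/-- **Unitary invariance of the ground energy**: `E₀(W A Wᴴ) = E₀(A)` for `W Wᴴ = 1` (spectrum is
conjugation invariant; cf. the tree's `Matrix.groundEnergy_unitary_conj`). [folklore] -/
private theorem groundEnergy_conj_of_unitary {m : Type*} [Fintype m] [DecidableEq m] {A W : Matrix m m ℂ}
    (hW : W * Wᴴ = 1) : (W * A * Wᴴ).groundEnergy = A.groundEnergy := by
  have hW' : Wᴴ * W = 1 := mul_eq_one_comm.1 hW
  have hU : W ∈ Matrix.unitaryGroup m ℂ := Matrix.mem_unitaryGroup_iff'.2 (by rw [star_eq_conjTranspose, hW'])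
  unfold Matrix.groundEnergy ContinuousLinearMap.groundEnergy
  rw [spectrum_toEuclideanCLM, spectrum_toEuclideanCLM]
  have h := Unitary.spectrum_star_right_conjugate (R := ℂ) (a := A) (U := ⟨W, hU⟩)
  change spectrum ℂ (W * A * star W) = spectrum ℂ A at h
  rw [star_eq_conjTranspose] at h
  rw [h]

/-- **The source-free grand-canonical `t–t'` torus `H^{tt'} − μN` is gauge invariant.**
[cite: BratteliRobinsonII1997, §5.2.2] -/
theorem gaugeAut_dWaveSourceTorusTT'_zero (θ : ℝ) :
    gaugeAut θ (dWaveSourceTorusTT' L t' U μ 0) = dWaveSourceTorusTT' L t' U μ 0 := by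
  refine forall_gaugeAut_eq_iff_commute.2 ?_ θ
  rw [totalNumberOp_eq_totalNumber, dWaveSourceTorusTT'_zero_source]
  exact ((hubbardTorusTT'_commute_totalNumber L 1 t' U).symm).sub_right ((Commute.refl _).smul_right _)

/-- `A_L(h) = A_L(0) − h(Δ_d + Δ_d†)`. [cite: KomaTasaki1994, §1] -/
theorem dWaveSourceTorusTT'_eq_zero_sub_smul (h : ℝ) :
    dWaveSourceTorusTT' L t' U μ h =
      dWaveSourceTorusTT' L t' U μ 0 - (h : ℂ) • (pairField dWaveFormFactor L + (pairField dWaveFormFactor L)ᴴ) := by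
  rw [dWaveSourceTorusTT'_zero_source, dWaveSourceTorusTT']

/-- A complex pair source with REAL coefficient `r` is the Koma–Tasaki source `r(Δ_d + Δ_d†)`:
`A_L(0) − (r̄Δ_d + rΔ_d†) = A_L(r)`. [cite: KomaTasaki1994, §1] -/
theorem dWaveSourceTorusTT'_zero_sub_realPhaseSource (r : ℝ) :
    dWaveSourceTorusTT' L t' U μ 0 -
        ((starRingEnd ℂ (r : ℂ)) • pairField dWaveFormFactor L + (r : ℂ) • (pairField dWaveFormFactor L)ᴴ) =
      dWaveSourceTorusTT' L t' U μ r := by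
  rw [Complex.conj_ofReal, ← smul_add, ← dWaveSourceTorusTT'_eq_zero_sub_smul]

variable (g : Site 2 → ℝ)

/-- **The gauge action rotates the phase of a complex pair source**:
`γ_θ(z̄·Δ_g + z·Δ_g†) = conj(z e^{2iθ})·Δ_g + (z e^{2iθ})·Δ_g†`. [cite: BratteliRobinsonII1997, §5.2.2] -/
theorem gaugeAut_phaseSource (θ : ℝ) (z : ℂ) :
    gaugeAut θ ((starRingEnd ℂ z) • pairField g L + z • (pairField g L)ᴴ) =
      (starRingEnd ℂ (z * exp (2 * (I * θ)))) • pairField g L + (z * exp (2 * (I * θ))) • (pairField g L)ᴴ := by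
  rw [gaugeAut_apply, Matrix.mul_add, Matrix.add_mul, Matrix.mul_smul, Matrix.smul_mul, Matrix.mul_smul,
    Matrix.smul_mul, ← gaugeAut_apply, ← gaugeAut_apply, hasGaugeCharge_pairField L g θ,
    hasGaugeCharge_pairField_conjTranspose L g θ, smul_smul, smul_smul]
  congr 1
  · congr 1
    rw [map_mul, ← Complex.exp_conj]
    simp only [map_mul, Complex.conj_I, Complex.conj_ofReal, map_ofNat]
    push_cast
    ring_nf
  · congr 1
    push_cast
    ring_nf

/-- `z · e^{−i arg z} = |z|`. [folklore] -/
private theorem mul_exp_neg_arg (z : ℂ) : z * exp (2 * (I * ((-(Complex.arg z / 2) : ℝ) : ℂ))) = (‖z‖ : ℂ) := by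
  have h1 : (‖z‖ : ℂ) * exp (Complex.arg z * I) = z := Complex.norm_mul_exp_arg_mul_I z
  have h2 : 2 * (I * ((-(Complex.arg z / 2) : ℝ) : ℂ)) = -(Complex.arg z * I) := by push_cast; ring
  rw [h2]
  calc z * exp (-(Complex.arg z * I)) = (‖z‖ : ℂ) * exp (Complex.arg z * I) * exp (-(Complex.arg z * I)) := by
        rw [h1]
    _ = (‖z‖ : ℂ) := by rw [mul_assoc, ← Complex.exp_add, add_neg_cancel, Complex.exp_zero, mul_one]

/-- **The sourced ground energy depends on a complex pair source only through its modulus**: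
`E₀(H^{tt'} − μN − (z̄Δ_d + zΔ_d†)) = E₀(dWaveSourceTorusTT' L t' U μ |z|)` — gauge-rotate by `θ = −arg z/2`.
[cite: BruPedra2013, §2.1] [cite: KomaTasaki1994, §1] -/
theorem groundEnergy_dWaveSourceTorusTT'_sub_phaseSource (z : ℂ) :
    (dWaveSourceTorusTT' L t' U μ 0 -
        ((starRingEnd ℂ z) • pairField dWaveFormFactor L + z • (pairField dWaveFormFactor L)ᴴ)).groundEnergy =
      (dWaveSourceTorusTT' L t' U μ ‖z‖).groundEnergy := by
  set θ : ℝ := -(Complex.arg z / 2) with hθ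
  have hrot : gaugeAut θ (dWaveSourceTorusTT' L t' U μ 0 -
      ((starRingEnd ℂ z) • pairField dWaveFormFactor L + z • (pairField dWaveFormFactor L)ᴴ)) =
      dWaveSourceTorusTT' L t' U μ ‖z‖ := by
    rw [gaugeAut_apply, Matrix.mul_sub, Matrix.sub_mul, ← gaugeAut_apply, ← gaugeAut_apply,
      gaugeAut_dWaveSourceTorusTT'_zero, gaugeAut_phaseSource, hθ, mul_exp_neg_arg,
      dWaveSourceTorusTT'_zero_sub_realPhaseSource]
  rw [← hrot, gaugeAut_apply]
  -- the gauge unitary's `U Uᴴ = 1` carries the `LinearOrder`-derived `DecidableEq` instance; bridge to the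
  -- library instance of this goal by `convert` (the instances are propositionally equal, `Subsingleton.elim`)
  have hW : fockGaugeU1 θ * (fockGaugeU1 θ)ᴴ = (1 : Matrix (Finset (Orb (FermionTorus 2 L))) (Finset (Orb (FermionTorus 2 L))) ℂ) := by
    convert fockGaugeU1_mul_conjTranspose_self (κ := Orb (FermionTorus 2 L)) θ using 2
    congr! 3
  exact (groundEnergy_conj_of_unitary hW).symm

/-- **Adding a complex pair source to `A_L(h₀)` lowers the ground energy at most like the real source
`h₀ + |z|`**: for `h₀ ≥ 0`, `E₀(dWaveSourceTorusTT' L t' U μ (h₀ + |z|)) ≤ E₀(A_L(h₀) − (z̄Δ_d + zΔ_d†))`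
(total source `h₀ + z`, `|h₀ + z| ≤ h₀ + |z|`, `E_L` antitone on `[0,∞)`). Step (γ) of the
approximating-Hamiltonian LRO ceiling. [cite: KomaTasaki1994, §1] [cite: BruPedra2013, §2.1] -/
theorem groundEnergy_dWaveSourceTorusTT'_add_le_groundEnergy_sub_phaseSource {h₀ : ℝ} (hh₀ : 0 ≤ h₀) (z : ℂ) :
    (dWaveSourceTorusTT' L t' U μ (h₀ + ‖z‖)).groundEnergy ≤
      (dWaveSourceTorusTT' L t' U μ h₀ -
        ((starRingEnd ℂ z) • pairField dWaveFormFactor L + z • (pairField dWaveFormFactor L)ᴴ)).groundEnergy := by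
  have hsrc : dWaveSourceTorusTT' L t' U μ h₀ -
      ((starRingEnd ℂ z) • pairField dWaveFormFactor L + z • (pairField dWaveFormFactor L)ᴴ) =
      dWaveSourceTorusTT' L t' U μ 0 -
        ((starRingEnd ℂ ((h₀ : ℂ) + z)) • pairField dWaveFormFactor L +
          ((h₀ : ℂ) + z) • (pairField dWaveFormFactor L)ᴴ) := by
    rw [dWaveSourceTorusTT'_eq_zero_sub_smul L t' U μ h₀, map_add, Complex.conj_ofReal, add_smul, add_smul,
      smul_add, sub_sub]
    congr 1
    abel
  have key := groundEnergy_dWaveSourceTorusTT'_sub_phaseSource L t' U μ ((h₀ : ℂ) + z)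
  have hanti : (dWaveSourceTorusTT' L t' U μ (h₀ + ‖z‖)).groundEnergy ≤
      (dWaveSourceTorusTT' L t' U μ ‖(h₀ : ℂ) + z‖).groundEnergy := by
    refine groundEnergy_dWaveSourceTorusTT'_anti L t' U μ (by positivity) ?_
    calc ‖(h₀ : ℂ) + z‖ ≤ ‖(h₀ : ℂ)‖ + ‖z‖ := norm_add_le _ _
      _ = h₀ + ‖z‖ := by rw [Complex.norm_real, Real.norm_of_nonneg hh₀]
  calc (dWaveSourceTorusTT' L t' U μ (h₀ + ‖z‖)).groundEnergy
      ≤ (dWaveSourceTorusTT' L t' U μ ‖(h₀ : ℂ) + z‖).groundEnergy := hanti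
    _ = (dWaveSourceTorusTT' L t' U μ 0 -
        ((starRingEnd ℂ ((h₀ : ℂ) + z)) • pairField dWaveFormFactor L +
          ((h₀ : ℂ) + z) • (pairField dWaveFormFactor L)ᴴ)).groundEnergy := key.symm
    _ = _ := congrArg Matrix.groundEnergy hsrc.symm

/-- `t' = 0` form: `E₀(dWaveSourceTorus L U μ (h₀ + |z|)) ≤ E₀(dWaveSourceTorus L U μ h₀ − (z̄Δ_d + zΔ_d†))`.
[cite: KomaTasaki1994, §1] -/
theorem groundEnergy_dWaveSourceTorus_add_le_groundEnergy_sub_phaseSource {h₀ : ℝ} (hh₀ : 0 ≤ h₀) (z : ℂ) :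
    (dWaveSourceTorus L U μ (h₀ + ‖z‖)).groundEnergy ≤
      (dWaveSourceTorus L U μ h₀ -
        ((starRingEnd ℂ z) • pairField dWaveFormFactor L + z • (pairField dWaveFormFactor L)ᴴ)).groundEnergy := by
  have h := groundEnergy_dWaveSourceTorusTT'_add_le_groundEnergy_sub_phaseSource L 0 U μ hh₀ z
  rwa [dWaveSourceTorusTT'_zero_tp, dWaveSourceTorusTT'_zero_tp] at h

/-- `t' = 0` modulus form: `E₀(dWaveSourceTorus L U μ 0 − (z̄Δ_d + zΔ_d†)) = E₀(dWaveSourceTorus L U μ |z|)`.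
[cite: BruPedra2013, §2.1] -/
theorem groundEnergy_dWaveSourceTorus_sub_phaseSource (z : ℂ) :
    (dWaveSourceTorus L U μ 0 -
        ((starRingEnd ℂ z) • pairField dWaveFormFactor L + z • (pairField dWaveFormFactor L)ᴴ)).groundEnergy =
      (dWaveSourceTorus L U μ ‖z‖).groundEnergy := by
  have h := groundEnergy_dWaveSourceTorusTT'_sub_phaseSource L 0 U μ z
  rwa [dWaveSourceTorusTT'_zero_tp, dWaveSourceTorusTT'_zero_tp] at h

end PhaseRotation

end Literature.MathematicalPhysics.QuantumLattice

end
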